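import Summits.QuantumFields.YangMills.Theses.SpecificationCompactness
import Summits.QuantumFields.YangMills.Theorems.SpecificationCompactnessScheffeUnbounded
import Literature.MathematicalPhysics.QuantumFieldTheory.Balaban1983to89.T3HeightwiseDensityBounds

/-!
# `DensityMergingAE` (route `SpecificationCompactness`, LINE 14 «tail_trivial_kernel», support S1°,
# stmt-QuantumFields-22689) — PROVED

For every torus family `F`, `γ > 0` and single-link profiles `q_e` (measurable, `≥ 0`, fibre-normalised
`π₀[q_e | links ≠ e] = 1` a.e.): if the canonical single-link conditional densities converge IN π₀-MEASURE,
`ρ̂_K/π₀[ρ̂_K | links ≠ e] → q_e`, and the normalised densities `ũ_K = ρ̂_K/∫ρ̂_K` are uniformly integrable, then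
`∫ |ũ_K − π₀[ũ_K | links ≠ e]·q_e| dπ₀ → 0` for every link `e`.  This file only INSTANTIATES the route-independent kernel
`tendsto_integral_abs_sub_condExp_mul_unbounded` (`SpecificationCompactnessScheffeUnbounded.lean`: Scheffé without fibres and
without a bound on `q`) on `X₀ = SU(2)^{unit bonds}`, `π₀` = product Haar, `m = σ(links ≠ e)`, `ũ_K = (∫ρ̂_K)⁻¹ρ̂_K`.

HONEST FRAMING.  Measure theory only (rung R3 RECORD line): the cruxes `SpecificationLimitAE` / `UnitDensityUI` are
hypotheses, nothing is proved about them, about `ContinuumYM3Torus`, or about the YM mass gap.  No definitions, no named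
facts. [folklore] ([cite: Georgii2011, Thm 4.17] for the DLR pattern; [cite: Balaban1985UV3, (2) p.256] for the unit laws.)
-/

noncomputable section

namespace Summit.QuantumFields.YangMills.Theorems.SpecificationCompactnessDensityMerging

open MeasureTheory Filter Topology
open Summit.QuantumFields.YangMills.Theorems.SpecificationCompactnessKernel
open Literature.MathematicalPhysics.QuantumFieldTheory.Balaban1983to89
open Literature.MathematicalPhysics.QuantumFieldTheory.Balaban1983to89.T3ContinuumYM3Torus
open Literature.MathematicalPhysics.QuantumFieldTheory.Balaban1983to89.Missing
open Literature.MathematicalPhysics.QuantumFieldTheory.Balaban1983to89.T4Continuum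
open Literature.MathematicalPhysics.QuantumFieldTheory.Balaban1983to89.T3ThresholdRemoval
open Literature.MathematicalPhysics.QuantumFieldTheory.Balaban1983to89.T3UnitLawDensityEML

/-- The renormalised unit density has POSITIVE total mass `∫ ρ̂_K dπ₀ > 0` (the unit law `Z⁻¹ρ̂_K·π₀` is a probability measure).
[cite: Balaban1985UV3, (2) p.256] -/
theorem integral_unitDensity_pos (F : T3Family) {γ : ℝ} (hγ : 0 ≤ γ) (K : ℕ) :
    0 < ∫ W, unitDensity F γ K W ∂fieldMeasure (F.P 0) 0 (Matrix.specialUnitaryGroup (Fin 2) ℂ) := by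
  obtain ⟨hdm, hd0, -⟩ := unitDensity_props F K hγ
  have hZ : 0 < partitionFn (G := Matrix.specialUnitaryGroup (Fin 2) ℂ) (F.P K) ((F.scheme ℰp γ).β K) :=
    partitionFn_pos' _ (F.scheme_β_nonneg ℰp hγ K)
  set Z := partitionFn (G := Matrix.specialUnitaryGroup (Fin 2) ℂ) (F.P K) ((F.scheme ℰp γ).β K) with hZdef
  haveI := isProbabilityMeasure_unitLaw (F := F) (ℰ := ℰp) measurableE_ℰp hγ K
  have h1 : ∫ _u, (1 : ℝ) ∂F.unitLaw ℰp measurableE_ℰp γ K = 1 := by simp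
  rw [unitLaw_eq_withDensity_emlDensity F K hγ] at h1
  have h2 := integral_lawOf (π := fieldMeasure (F.P 0) 0 (Matrix.specialUnitaryGroup (Fin 2) ℂ))
    (u := fun u => Z⁻¹ * unitDensity F γ K u) (hdm.const_mul _)
    (fun u => mul_nonneg (inv_nonneg.mpr hZ.le) (hd0 u)) (fun _ => (1 : ℝ))
  rw [h2] at h1
  simp only [mul_one, integral_const_mul] at h1
  have hinv : 0 < Z⁻¹ := inv_pos.mpr hZ
  nlinarith

/-- **`DensityMergingAE` (route `SpecificationCompactness`, support S1°, stmt-QuantumFields-22689) HOLDS.**  The route-independent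
unbounded-profile Scheffé step instantiated on `X₀ = SU(2)^{unit bonds}` with product Haar `π₀`, `m = σ(links ≠ e)` and
`ũ_K = (∫ρ̂_K)⁻¹ρ̂_K`.  Rung R3 RECORD line; no crux, no instance of `ContinuumYM3Torus` and nothing about the YM mass gap is
proved here. [cite: Georgii2011, Thm 4.17] -/
theorem densityMergingAE_proof :
    Summit.QuantumFields.YangMills.Theses.SpecificationCompactness.DensityMergingAE := by
  intro F γ hγ q hq hlim hUI e
  obtain ⟨hqm, hq0, -, hq1⟩ := hq
  -- the setting
  set π₀ : Measure (GaugeField (F.P 0) 0 (Matrix.specialUnitaryGroup (Fin 2) ℂ)) :=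
    fieldMeasure (F.P 0) 0 (Matrix.specialUnitaryGroup (Fin 2) ℂ) with hπ₀
  haveI : IsProbabilityMeasure π₀ := Missing.isProbabilityMeasure_fieldMeasure (F.P 0) 0
  set r : GaugeField (F.P 0) 0 (Matrix.specialUnitaryGroup (Fin 2) ℂ) →
      ({b : PBond (F.P 0) 0 // b ≠ e} → Matrix.specialUnitaryGroup (Fin 2) ℂ) := fun W b => W b.1 with hr
  have hm : MeasurableSpace.comap r MeasurableSpace.pi ≤
      (inferInstance : MeasurableSpace (GaugeField (F.P 0) 0 (Matrix.specialUnitaryGroup (Fin 2) ℂ))) :=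
    Measurable.comap_le (measurable_pi_lambda _ fun b => measurable_pi_apply (b.1 : PBond (F.P 0) 0))
  -- the normalised densities
  obtain hprops := fun K => unitDensity_props F K hγ.le
  set u : ℕ → GaugeField (F.P 0) 0 (Matrix.specialUnitaryGroup (Fin 2) ℂ) → ℝ :=
    fun K V => (∫ W, unitDensity F γ K W ∂π₀)⁻¹ * unitDensity F γ K V with hu
  have hZ : ∀ K, 0 < ∫ W, unitDensity F γ K W ∂π₀ := fun K => integral_unitDensity_pos F hγ.le K
  have hum : ∀ K, Measurable (u K) := fun K => (hprops K).1.const_mul _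
  have hu0 : ∀ K x, 0 ≤ u K x := fun K x => mul_nonneg (inv_nonneg.mpr (hZ K).le) ((hprops K).2.1 x)
  have hui : ∀ K, Integrable (u K) π₀ := fun K => (hprops K).2.2.const_mul _
  -- the ratios do not see the normalisation
  have hlim' : TendstoInMeasure π₀ (fun K V => u K V / π₀[u K|MeasurableSpace.comap r MeasurableSpace.pi] V)
      atTop (q e) := by
    have hsm : ∀ K, π₀[u K|MeasurableSpace.comap r MeasurableSpace.pi] =ᵐ[π₀]
        fun V => (∫ W, unitDensity F γ K W ∂π₀)⁻¹ * π₀[unitDensity F γ K|MeasurableSpace.comap r MeasurableSpace.pi] V :=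
      fun K => by
        have h := condExp_smul (μ := π₀) ((∫ W, unitDensity F γ K W ∂π₀)⁻¹) (unitDensity F γ K)
          (MeasurableSpace.comap r MeasurableSpace.pi)
        have he : ((∫ W, unitDensity F γ K W ∂π₀)⁻¹ • unitDensity F γ K) = u K := by
          funext V; simp [hu, smul_eq_mul]
        rw [he] at h
        filter_upwards [h] with V hV
        rw [hV]; simp [smul_eq_mul]
    refine (hlim e).congr (fun K => ?_) EventuallyEq.rfl
    filter_upwards [hsm K] with V hV
    rw [hV]
    simp only [hu]
    rw [mul_div_mul_left _ _ (ne_of_gt (inv_pos.mpr (hZ K)))]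
  exact tendsto_integral_abs_sub_condExp_mul_unbounded (π := π₀) hm hum hu0 hui (hqm e) (hq0 e) (hq1 e) hlim' hUI

end Summit.QuantumFields.YangMills.Theorems.SpecificationCompactnessDensityMerging

end
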